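import Summits.ValiantsHypothesis.ValiantsHypothesis.Theorems.PolyaContinuedMonotoneCoverHardWidthBet

/-!
# Crux `MonotoneCoverHard` (stmt-ValiantsHypothesis-7421, route PolyaContinued, rank 2) — skeleton of
line `width-cut` (PREPARED by prover val-width-7421-p2 g0, 2026-08-27; NOT registered — registering it
would replace the active line `few_state_cut`, a planner / director decision)

WIDTH REFORMULATION of the registered line `few_state_cut`, with everything except ONE structural stub
in the tree (all `Theorems/PolyaContinuedMonotoneCoverHard*.lean`, ns
`…Theorems.PolyaContinuedMonotoneCoverHard`; calibration memo `Cruxes/MonotoneCoverHard/CALIBRATION-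
few_state_cut.md`):

* the registered bet `FewStateCut.stub_fewStateCut` is kernel-EQUIVALENT to (weakly-exponential size
  bound for label-bijective Pfaffian covers) ∧ (a balanced vertex set exists) — `…BetCalibrationClosed`;
* every label-bijective cover whose nonzero edges are all used HAS a level function — `…LevelFunction`,
  `exists_level_function` (elementary: return walks along `τ₀⁻¹ ∘ τ` orbits, zero weight of simple
  closed walks by flipping the cycle permutation, generic potentials `…ClosedWalk`);
* width profiles are matching-independent and a balanced level exists unless a level is fat —
  `…WidthTwo` (`varCount_eq`, `exists_balanced_level`);
* the layer cut at a balanced level `h` has `≤ m^(c_h + c_{h−1})` states, so with val-width-7421-p1's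
  rectangle bound `2^(n/3) ≤ m^(c_h + c_{h−1})` — `…WidthCut`, Pfaffian-free form in `…WidthBet`;
* rungs: the crux HOLDS for graded covers (`…GradedLowerBound`, all ABP / Grenet / decision-tree covers)
  and for levelled covers of width `≤ 2` (`…WidthTwo`);
* **`monotoneCoverHard_of_widthBet : WidthBet → MonotoneCoverHard`** (`…WidthBet`), where `WidthBet`
  is exactly the statement of `stub_width` below.

So this skeleton is two lines long: the crux follows BY NAME from the single stub.  Content of the bet:
a level of width `w` means `w` variable edges of EVERY weight-nonzero perfect matching run in parallel
between the same two vertex layers while the matchings still biject with `S_n`; keeping parallel tokens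
coherent needs coupling between lanes, which in every example is `K_{w,w}`-like (a central `K_{3,3}` for
`w ≥ 3`, excluded by Little's theorem) or sequential (width 1).  First falsifier: ANY label-bijective
Pfaffian cover of `per_n`, `n ≥ 3`, with a balanced level pair wider than the bound — e.g. a ONE-level
cover of `per_3` (all three variable edges of every matching in parallel) at any size.  Calibration:
`MonotoneCoverHard` is OPEN (proved here for graded and width-≤-2 covers); for `m ≤ qp(n)` the bet
implies the crux and for mid-size `m` it says more; VP ≠ VNP is not moved by this file.
-/

set_option linter.dupNamespace false

namespace Summit.ValiantsHypothesis.ValiantsHypothesis.Cruxes.MonotoneCoverHard.WidthCut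

open Summit.ValiantsHypothesis.ValiantsHypothesis.Theses.PolyaContinued
open Summit.ValiantsHypothesis.ValiantsHypothesis.Theorems.PolyaContinuedMonotoneCoverHard
  (monotoneCoverHard_of_widthBet)
open scoped Classical

/-- STUB — THE WIDTH BET: uniformly (`∃ d n₀`), for every label-bijective Pfaffian cover of `per_n`,
`n ≥ n₀`, on `m + m` vertices and every level function `g` on its used edges (`g(col) = g(row) +
[label is a variable]` along every edge of every weight-nonzero perfect matching), some level `h ≥ 1` is
BALANCED (every weight-nonzero perfect matching has between `n/3` and `2n/3` variable edges with row
level `< h`) and the widths `c_h, c_{h-1}` (numbers of variable edges of the weight-nonzero matchings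
leaving row level `h`, resp. `h - 1` — matching-independent by `varCount_eq`) satisfy
`c_h + c_{h-1} ≤ (log₂ m + d)^d`. -/
theorem stub_width :
    ∃ d n₀ : ℕ, ∀ (n m : ℕ) (E : Finset (Fin m × Fin m))
      (a : Fin m × Fin m → MvPolynomial (Fin n × Fin n) ℂ), n₀ ≤ n →
      (∃ s : Fin m × Fin m → ℂ, (∀ e, s e = 1 ∨ s e = -1) ∧
        (Matrix.of fun i j => if (i, j) ∈ E then MvPolynomial.C (s (i, j)) * MvPolynomial.X (i, j)
            else 0 : Matrix (Fin m) (Fin m) (MvPolynomial (Fin m × Fin m) ℂ)).det =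
          (Matrix.of fun i j => if (i, j) ∈ E then MvPolynomial.X (i, j) else 0 :
            Matrix (Fin m) (Fin m) (MvPolynomial (Fin m × Fin m) ℂ)).permanent) →
      (∀ e, (∃ j, a e = MvPolynomial.X j) ∨ a e = 0 ∨ a e = 1) →
      Literature.Computability.AlgebraicComplexity.perPoly (Fin n) ℂ =
        MvPolynomial.aeval a (Matrix.of fun i j => if (i, j) ∈ E then MvPolynomial.X (i, j) else 0 :
            Matrix (Fin m) (Fin m) (MvPolynomial (Fin m × Fin m) ℂ)).permanent →
      ∀ g : Fin m ⊕ Fin m → ℕ,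
        (∀ τ : Equiv.Perm (Fin m), (∀ i, (i, τ i) ∈ E ∧ a (i, τ i) ≠ 0) → ∀ i,
          (∃ k, a (i, τ i) = MvPolynomial.X k) → g (Sum.inr (τ i)) = g (Sum.inl i) + 1) →
        (∀ τ : Equiv.Perm (Fin m), (∀ i, (i, τ i) ∈ E ∧ a (i, τ i) ≠ 0) → ∀ i,
          (¬ ∃ k, a (i, τ i) = MvPolynomial.X k) → g (Sum.inr (τ i)) = g (Sum.inl i)) →
        ∃ h ch cq : ℕ, 1 ≤ h ∧
          (∀ τ : Equiv.Perm (Fin m), (∀ i, (i, τ i) ∈ E ∧ a (i, τ i) ≠ 0) →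
            n ≤ 3 * (Finset.univ.filter fun i : Fin m =>
                (∃ k, a (i, τ i) = MvPolynomial.X k) ∧ g (Sum.inl i) < h).card ∧
              3 * (Finset.univ.filter fun i : Fin m =>
                (∃ k, a (i, τ i) = MvPolynomial.X k) ∧ g (Sum.inl i) < h).card ≤ 2 * n) ∧
          (∀ τ : Equiv.Perm (Fin m), (∀ i, (i, τ i) ∈ E ∧ a (i, τ i) ≠ 0) →
            (Finset.univ.filter fun i : Fin m =>
              (∃ k, a (i, τ i) = MvPolynomial.X k) ∧ g (Sum.inl i) = h).card = ch) ∧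
          (∀ τ : Equiv.Perm (Fin m), (∀ i, (i, τ i) ∈ E ∧ a (i, τ i) ≠ 0) →
            (Finset.univ.filter fun i : Fin m =>
              (∃ k, a (i, τ i) = MvPolynomial.X k) ∧ g (Sum.inl i) = h - 1).card = cq) ∧
          ch + cq ≤ (Nat.log 2 m + d) ^ d := by
  sorry

/-- THE PIECE `MonotoneCoverHard` BY NAME from the single stub. -/
theorem MonotoneCoverHard_of : MonotoneCoverHard :=
  monotoneCoverHard_of_widthBet stub_width

end Summit.ValiantsHypothesis.ValiantsHypothesis.Cruxes.MonotoneCoverHard.WidthCut
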